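import Summits.CriticalPhenomena.PercolationContinuityZ3.Theorems.PercNearOneGluingNoHeavyLowerTailReduction
import Literature.Probability.Percolation.KozmaNitzanPreFKG
import HarnessLib

/-!
# `NoHeavyLowerTail` (stmt-CriticalPhenomena-4575), one-cut line — the SHARP one-cut bound for CENTRAL observers

Support file (route-task line `one-cut-mincut-submodularity`, `--supports stmt-CriticalPhenomena-4575`).
For `μ = prodBernoulli w` on `Fin n`, an observer `o`, a relay set `A`, `N = |{a ∈ A : o ↔ a}|` and
`E N = Σ_{a ∈ A} P(o ↔ a)`:

* `lowerTail_le_markov_self` — the observer-hub Markov bound: for every threshold `θ < |A|`,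
  `P(N < θ) ≤ (|A| − E N) / (|A| − θ)` (the tree's `nhlt_hubBlockMarkov` with the hub `a₀ := o`).
* `oneCut_of_central` — **if every relay is `s`-connected to the observer, `s ≤ P(o ↔ a)` for all `a ∈ A`
  (`0 ≤ s ≤ 1`), then `P(1 ≤ N ∧ N < E N / 2) ≤ 1 − s²`**, with NO hypothesis on the pairwise connections:
  `E N ≥ s|A|`, the Markov bound at `θ = E N/2` is `2(|A| − E N)/(2|A| − E N) ≤ 2(1 − s)/(2 − s)`, and
  `2(1 − s)/(2 − s) ≤ (1 − s)(1 + s)` because `s(1 − s) ≥ 0`.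
* `oneCut_of_central_sq` — the same in the binder shape of the one-cut engine
  (`Theorems.noHeavyLowerTail_of_oneCut`, registered stub `stub_oneCut`): if `1 − t ≤ P(o ↔ a)²` for every
  `a ∈ A` then `P(1 ≤ N ∧ N < E N/2) ≤ t`.  So the sharp one-cut bound (`constant 1`, threshold `E N/2`)
  holds for every observer lying in the "`√(1−t)`-ball" of all relays — in particular for the tree-metric
  CENTRE of a relay set of diameter `t` on a tree — by Markov alone; the content of the engine is the
  PERIPHERAL observer (union-versus-max gap: at a central observer the union/Markov bound already meets the
  single worst cut).  Tight: `s ∈ {0, 1}` only; for the two-blob equality family of the engine the observer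
  is NOT central (`P(o ↔ a) = 1 − t < √(1 − t)` across the cut).

No definitions, no named facts, no sorries.
-/

noncomputable section

namespace Summit.CriticalPhenomena.PercolationContinuityZ3.Theorems

open MeasureTheory Set Literature.Probability.LatticeModels Literature.Probability.Percolation
open scoped Classical BigOperators

/-- The elementary inequality behind the central case: `2(1 − s)/(2 − s) ≤ 1 − s²` for `0 ≤ s ≤ 1`
(equivalently `s (1 − s)² ≥ 0`). [folklore] -/
theorem two_mul_one_sub_div_two_sub_le (s : ℝ) (hs0 : 0 ≤ s) (hs1 : s ≤ 1) :
    2 * (1 - s) / (2 - s) ≤ 1 - s ^ 2 := by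
  have h2 : 0 < 2 - s := by linarith
  rw [div_le_iff₀ h2]
  nlinarith [mul_nonneg hs0 (mul_self_nonneg (1 - s))]

/-- **Observer-hub Markov bound.**  For every threshold `θ < |A|`:
`P(N < θ) ≤ (|A| − E N)/(|A| − θ)`, `N = |{a ∈ A : o ↔ a}|`, `E N = Σ_{a∈A} P(o ↔ a)`
(Markov's inequality for the deficit `|A| − N`, whose mean is `|A| − E N`; this is
`Theorems.nhlt_hubBlockMarkov` with the hub `a₀ := o`, using `o ↔ o`). [folklore] -/
theorem lowerTail_le_markov_self {n : ℕ} (w : Sym2 (Fin n) → unitInterval) (A : Finset (Fin n))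
    (o : Fin n) (θ : ℝ) (hθ : θ < A.card) :
    (prodBernoulli w).real {ω : BondConfig (Fin n) |
        ((A.filter fun a => ω ∈ openConn o a).card : ℝ) < θ}
      ≤ ((A.card : ℝ) - ∑ a ∈ A, (prodBernoulli w).real (openConn o a)) / (A.card - θ) := by
  set μ := prodBernoulli w with hμ
  have hM := nhlt_hubBlockMarkov n w A o o θ hθ
  have hset : {ω : BondConfig (Fin n) | ((A.filter fun a => ω ∈ openConn o a).card : ℝ) < θ} =
      {ω : BondConfig (Fin n) | ω ∈ openConn o o ∧
        ((A.filter fun a => ω ∈ openConn o a).card : ℝ) < θ} := by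
    ext ω
    simp only [Set.mem_setOf_eq]
    exact ⟨fun h => ⟨SimpleGraph.Reachable.refl o, h⟩, fun h => h.2⟩
  have hsum : ∑ a ∈ A, μ.real (openConn a o)ᶜ = (A.card : ℝ) - ∑ a ∈ A, μ.real (openConn o a) := by
    have : ∀ a ∈ A, μ.real (openConn a o)ᶜ = 1 - μ.real (openConn o a) := by
      intro a _
      rw [probReal_compl_eq_one_sub (measurableSet_openConn_holds a o), KNPreFKG.openConn_symm a o]
    rw [Finset.sum_congr rfl this, Finset.sum_sub_distrib, Finset.sum_const, nsmul_eq_mul, mul_one]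
  rw [hset, ← hsum]
  exact hM

/-- **Sharp one-cut bound for a central observer.**  If `0 ≤ s ≤ 1` and `s ≤ P(o ↔ a)` for every
`a ∈ A`, then `P(1 ≤ N ∧ N < E N / 2) ≤ 1 − s²` (`N = |{a ∈ A : o ↔ a}|`, `E N = Σ_{a∈A} P(o ↔ a)`);
no hypothesis on the pairwise connections among relays is needed.  Proof: `E N ≥ s|A|`, the observer-hub
Markov bound at `θ = E N/2` is `2(|A| − E N)/(2|A| − E N)`, decreasing in `E N`, hence
`≤ 2(1 − s)/(2 − s) ≤ 1 − s²`. [folklore] -/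
theorem oneCut_of_central {n : ℕ} (w : Sym2 (Fin n) → unitInterval) (A : Finset (Fin n)) (o : Fin n)
    (s : ℝ) (hs0 : 0 ≤ s) (hs1 : s ≤ 1)
    (hcen : ∀ a ∈ A, s ≤ (prodBernoulli w).real (openConn o a)) :
    (prodBernoulli w).real {ω : BondConfig (Fin n) |
        1 ≤ (A.filter fun a => ω ∈ openConn o a).card ∧
        ((A.filter fun a => ω ∈ openConn o a).card : ℝ) <
          (∑ a ∈ A, (prodBernoulli w).real (openConn o a)) / 2}
      ≤ 1 - s ^ 2 := by
  set μ := prodBernoulli w with hμ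
  set m : ℝ := ∑ a ∈ A, μ.real (openConn o a) with hm
  set k : ℝ := (A.card : ℝ) with hk
  by_cases hA : A = ∅
  · -- no relays: the event is empty
    have hempty : {ω : BondConfig (Fin n) | 1 ≤ (A.filter fun a => ω ∈ openConn o a).card ∧
        ((A.filter fun a => ω ∈ openConn o a).card : ℝ) < m / 2} = ∅ := by
      ext ω; simp [hA]
    rw [hempty, measureReal_empty]
    nlinarith
  have hkpos : 1 ≤ k := by
    have : 1 ≤ A.card := Finset.card_pos.2 (Finset.nonempty_iff_ne_empty.2 hA)
    rw [hk]; exact_mod_cast this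
  have hm_le : m ≤ k := by
    calc m ≤ ∑ _a ∈ A, (1 : ℝ) := Finset.sum_le_sum fun a _ => measureReal_le_one
      _ = k := by simp [hk]
  have hm_ge : s * k ≤ m := by
    calc s * k = ∑ _a ∈ A, s := by simp [hk, mul_comm]
      _ ≤ m := Finset.sum_le_sum fun a ha => hcen a ha
  have hθ : m / 2 < (A.card : ℝ) := by rw [← hk]; linarith
  -- drop `1 ≤ N` and apply the observer-hub Markov bound
  have h1 : μ.real {ω : BondConfig (Fin n) | 1 ≤ (A.filter fun a => ω ∈ openConn o a).card ∧
        ((A.filter fun a => ω ∈ openConn o a).card : ℝ) < m / 2}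
      ≤ μ.real {ω : BondConfig (Fin n) | ((A.filter fun a => ω ∈ openConn o a).card : ℝ) < m / 2} :=
    measureReal_mono (fun ω hω => hω.2)
  have h2 := lowerTail_le_markov_self w A o (m / 2) hθ
  rw [← hk, ← hm] at h2
  have hden : 0 < k - m / 2 := by linarith
  -- `(k - m)/(k - m/2) ≤ 2(1 - s)/(2 - s) ≤ 1 - s²`
  have h3 : (k - m) / (k - m / 2) ≤ 2 * (1 - s) / (2 - s) := by
    rw [div_le_div_iff₀ hden (by linarith)]
    nlinarith
  calc _ ≤ _ := h1
    _ ≤ (k - m) / (k - m / 2) := h2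
    _ ≤ 2 * (1 - s) / (2 - s) := h3
    _ ≤ 1 - s ^ 2 := two_mul_one_sub_div_two_sub_le s hs0 hs1

/-- **Sharp one-cut bound for a central observer, engine binder shape.**  For every finite weighted
graph, relay set `A`, observer `o` and `t ≥ 0`: if `1 − t ≤ P(o ↔ a)²` for every `a ∈ A` (the observer
lies in the `√(1−t)`-ball of every relay), then `P(1 ≤ N ∧ N < E N / 2) ≤ t` — the conclusion of the
registered one-cut stub `stub_oneCut` for this class of observers, whatever the pairwise connections.
[folklore] -/
theorem oneCut_of_central_sq :
    ∀ (n : ℕ) (w : Sym2 (Fin n) → unitInterval) (A : Finset (Fin n)) (o : Fin n) (t : ℝ), 0 ≤ t →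
      (∀ a ∈ A, 1 - t ≤
        ((Literature.Probability.LatticeModels.prodBernoulli w).real
          (Literature.Probability.Percolation.openConn o a)) ^ 2) →
      (Literature.Probability.LatticeModels.prodBernoulli w).real
        {ω : Literature.Probability.Percolation.BondConfig (Fin n) |
          1 ≤ (A.filter fun a => ω ∈ Literature.Probability.Percolation.openConn o a).card ∧
          ((A.filter fun a => ω ∈ Literature.Probability.Percolation.openConn o a).card : ℝ) <
            (∑ a ∈ A, (Literature.Probability.LatticeModels.prodBernoulli w).real
              (Literature.Probability.Percolation.openConn o a)) / 2} ≤ t := by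
  intro n w A o t ht hcen
  set μ := prodBernoulli w with hμ
  by_cases ht1 : 1 ≤ t
  · exact le_trans measureReal_le_one ht1
  push Not at ht1
  -- `s := √(1 - t)`, so that `1 - s² = t` and `s ≤ P(o ↔ a)`
  set s : ℝ := Real.sqrt (1 - t) with hs
  have h1t : 0 ≤ 1 - t := by linarith
  have hs0 : 0 ≤ s := Real.sqrt_nonneg _
  have hs1 : s ≤ 1 := by
    rw [hs, Real.sqrt_le_one]
    linarith
  have hss : s ^ 2 = 1 - t := by rw [hs, Real.sq_sqrt h1t]
  have hcen' : ∀ a ∈ A, s ≤ μ.real (openConn o a) := by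
    intro a ha
    have hp0 : 0 ≤ μ.real (openConn o a) := measureReal_nonneg
    rw [hs]
    exact Real.sqrt_le_iff.2 ⟨hp0, hcen a ha⟩
  have key := oneCut_of_central w A o s hs0 hs1 hcen'
  rw [hss] at key
  linarith [key]

end Summit.CriticalPhenomena.PercolationContinuityZ3.Theorems

end
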